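import Mathlib
import HarnessLib
import Summits.Ventures.LatticeQCDFlow.Scaling.MartingaleLogWeightCLT

/-!
# LatticeQCDFlow / Scaling — THE LOSS LAW FOR MARTINGALE (AUTOREGRESSIVE) LOG-WEIGHTS: small
# likelihood-ratio increments with mean quadratic variation `→ s` have training loss `E[−L] → s/2`

HONEST FRAMING: exact (Metropolis-corrected) sampling algorithms for lattice gauge theory;
figures of merit are autocorrelation/cost numbers at stated couplings and volumes; no
continuum-physics claim.

Venture `LatticeQCDFlow` (cell pub-lqcd), topic `Scaling`; FANOUT row 3 (`s0-u1-a`, S0-B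
implementation A, GEN-20).  NEW WORK of the cell (elementary), on row 3's GEN-19
`Scaling/MartingaleLogWeightCLT` (imported for its setting and its real estimates
`abs_log_one_add_taylor_two_le`, `abs_expm1_sq_sub_sq_le`; there: `L_n = Σ_t ℓ_{n,t} ⇒ N(−s/2, s)` and
`E e^{L_n} = 1`); NO definition is introduced; nothing is cited.

## Setting and statement

An array of per-site log-likelihood-ratio increments `ℓ_{n,t}` (`t < k_n`) on one probability space
with the LIKELIHOOD-RATIO MARTINGALE property `E[F(ℓ_{n,<t})·(e^{ℓ_{n,t}} − 1)] = 0` (bounded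
measurable `F`) and `|ℓ_{n,t}| ≤ c_n → 0` — the log-weight of an autoregressive (site-by-site) flow
against its target, `L_n = Σ_t ℓ_{n,t}`, `E e^{L_n} = 1`, so that the flow's reverse training loss is
`KL(q ‖ p) = E_q[−L_n]`.
* `abs_neg_add_expm1_sub_half_sq_le` — pointwise: `|−x + (e^x − 1) − x²/2| ≤ 18·c·x²` for
  `|x| ≤ c ≤ 1/4` (`log(1+η) = η − η²/2 + O(η³)` read backwards);
* `abs_integral_neg_sub_half_integral_sq_le` — one increment: `|E[−ℓ] − E[ℓ²]/2| ≤ 18c·E[ℓ²]`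
  (the martingale property kills `E[e^ℓ − 1]`);
* **`martingale_loss_tendsto`** — if the MEAN quadratic variation converges, `E[Σ_t ℓ_{n,t}²] → s`,
  then the training loss `E[−L_n] → s/2`.

Reading (value-free): with `Scaling/MartingaleLogNormalUniversality` (acceptance `→ erfc(√s/2)` under
convergence of the quadratic variation in probability) the large-volume conversion
`acc = erfc(√(KL/2))` of `Scaling/AcceptanceAlongCouplingSequences` extends from factorised to
autoregressive exact flow samplers: the training loss and the acceptance are both functions of the one
number `s`, half of it and `erfc` of half its root.
NOT CLAIMED: convergence in probability of the quadratic variation does not by itself give the mean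
(`L¹`) convergence assumed here (uniform integrability is the gap); the forward loss `E_p[L]`; the
verification of the martingale property for a concrete architecture; rates; any value at the cell's
`(β, L)`; nothing re-scored.
-/

noncomputable section

namespace Summit.Ventures.LatticeQCDFlow.Theory2

open MeasureTheory ProbabilityTheory Filter Finset Real Set
open scoped Topology NNReal

/-! ## §1 The pointwise estimate -/

/-- `|−x + (e^x − 1) − x²/2| ≤ 18·c·x²` for `|x| ≤ c ≤ 1/4`. [ours] -/
theorem abs_neg_add_expm1_sub_half_sq_le {x c : ℝ} (hx : |x| ≤ c) (hc : c ≤ 1 / 4) :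
    |-x + (Real.exp x - 1) - x ^ 2 / 2| ≤ 18 * c * x ^ 2 := by
  have hx1 : |x| ≤ 1 := hx.trans (hc.trans (by norm_num))
  set η : ℝ := Real.exp x - 1 with hη
  have hη2 : |η| ≤ 2 * |x| := Real.abs_exp_sub_one_le hx1
  have hηhalf : |η| ≤ 1 / 2 := hη2.trans (by linarith [hx.trans hc])
  have hlog : Real.log (1 + η) = x := by rw [hη, add_sub_cancel, Real.log_exp]
  have h1 := abs_log_one_add_taylor_two_le hηhalf
  rw [hlog] at h1
  have h2 := abs_expm1_sq_sub_sq_le hx1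
  rw [← hη] at h2
  have e : -x + η - x ^ 2 / 2 = -(x - η + η ^ 2 / 2) + (η ^ 2 - x ^ 2) / 2 := by ring
  rw [e]
  have hx0 : 0 ≤ |x| := abs_nonneg x
  have hc0 : 0 ≤ c := hx0.trans hx
  calc |-(x - η + η ^ 2 / 2) + (η ^ 2 - x ^ 2) / 2|
      ≤ |-(x - η + η ^ 2 / 2)| + |(η ^ 2 - x ^ 2) / 2| := abs_add_le _ _
    _ = |x - η + η ^ 2 / 2| + |η ^ 2 - x ^ 2| / 2 := by rw [abs_neg, abs_div, abs_two]
    _ ≤ 2 * |η| ^ 3 + 3 * |x| ^ 3 / 2 := add_le_add h1 (by linarith)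
    _ ≤ 2 * (2 * |x|) ^ 3 + 3 * |x| ^ 3 / 2 := by
        have := pow_le_pow_left₀ (abs_nonneg η) hη2 3
        linarith
    _ = (35 / 2) * |x| * |x| ^ 2 := by ring
    _ ≤ 18 * c * x ^ 2 := by
        rw [sq_abs]
        have : (35 / 2 : ℝ) * |x| ≤ 18 * c := by linarith
        exact mul_le_mul_of_nonneg_right this (sq_nonneg x)

/-! ## §2 The loss law -/

section Martingale

variable {Ω : Type*} [MeasurableSpace Ω] {P : Measure Ω} [IsProbabilityMeasure P]
  {ℓ : ℕ → ℕ → Ω → ℝ} {k : ℕ → ℕ}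

/-- **One increment**: under the martingale property (`E[e^ℓ − 1] = 0`) and `|ℓ| ≤ c ≤ 1/4`,
`|E[−ℓ] − E[ℓ²]/2| ≤ 18c·E[ℓ²]`. [ours] -/
theorem abs_integral_neg_sub_half_integral_sq_le (hℓm : ∀ n t, Measurable (ℓ n t)) {c : ℕ → ℝ}
    (hc : ∀ n t ω, |ℓ n t ω| ≤ c n)
    (horth : ∀ (n t : ℕ) (F : (Fin t → ℝ) → ℝ) (K' : ℝ), Measurable F → (∀ w, |F w| ≤ K') →
      ∫ ω, F (fun i => ℓ n i ω) * (Real.exp (ℓ n t ω) - 1) ∂P = 0)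
    {n : ℕ} (hcn : c n ≤ 1 / 4) (t : ℕ) :
    |(∫ ω, -ℓ n t ω ∂P) - (∫ ω, ℓ n t ω ^ 2 ∂P) / 2| ≤ 18 * c n * ∫ ω, ℓ n t ω ^ 2 ∂P := by
  -- integrability of the bounded pieces
  have hi : Integrable (ℓ n t) P :=
    Integrable.of_bound (hℓm n t).aestronglyMeasurable (c n)
      (ae_of_all _ fun ω => by rw [Real.norm_eq_abs]; exact hc n t ω)
  have hc1 : ∀ ω, |ℓ n t ω| ≤ 1 := fun ω => (hc n t ω).trans (hcn.trans (by norm_num))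
  have hi2 : Integrable (fun ω => ℓ n t ω ^ 2) P := by
    refine Integrable.of_bound ((hℓm n t).pow_const 2).aestronglyMeasurable 1
      (ae_of_all _ fun ω => ?_)
    rw [Real.norm_eq_abs, abs_of_nonneg (sq_nonneg _), ← sq_abs]
    have := hc1 ω
    nlinarith [abs_nonneg (ℓ n t ω)]
  have hiη : Integrable (fun ω => Real.exp (ℓ n t ω) - 1) P := by
    refine Integrable.of_bound ((Real.measurable_exp.comp (hℓm n t)).sub measurable_const).aestronglyMeasurable
      2 (ae_of_all _ fun ω => ?_)
    rw [Real.norm_eq_abs]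
    exact (Real.abs_exp_sub_one_le (hc1 ω)).trans (by linarith [hc1 ω])
  -- `E[e^ℓ − 1] = 0`
  have hη0 : ∫ ω, (Real.exp (ℓ n t ω) - 1) ∂P = 0 := by
    have h := horth n t (fun _ => 1) 1 measurable_const (fun _ => by simp)
    simpa using h
  -- assemble
  have hsum : ∫ ω, (-ℓ n t ω + (Real.exp (ℓ n t ω) - 1) - ℓ n t ω ^ 2 / 2) ∂P
      = (∫ ω, -ℓ n t ω ∂P) - (∫ ω, ℓ n t ω ^ 2 ∂P) / 2 := by
    have hfg : Integrable (fun ω => -ℓ n t ω + (Real.exp (ℓ n t ω) - 1)) P := hi.neg.add hiη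
    rw [integral_sub hfg (hi2.div_const 2),
      integral_add (f := fun ω => -ℓ n t ω) (g := fun ω => Real.exp (ℓ n t ω) - 1) hi.neg hiη, hη0,
      add_zero, integral_div]
  rw [← hsum]
  calc |∫ ω, (-ℓ n t ω + (Real.exp (ℓ n t ω) - 1) - ℓ n t ω ^ 2 / 2) ∂P|
      ≤ ∫ ω, |-ℓ n t ω + (Real.exp (ℓ n t ω) - 1) - ℓ n t ω ^ 2 / 2| ∂P := by
        have h := norm_integral_le_integral_norm (μ := P)
          (fun ω => -ℓ n t ω + (Real.exp (ℓ n t ω) - 1) - ℓ n t ω ^ 2 / 2)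
        simp only [Real.norm_eq_abs] at h
        exact h
    _ ≤ ∫ ω, 18 * c n * ℓ n t ω ^ 2 ∂P := by
        refine integral_mono_of_nonneg (ae_of_all _ fun ω => abs_nonneg _) (hi2.const_mul _)
          (ae_of_all _ fun ω => abs_neg_add_expm1_sub_half_sq_le (hc n t ω) hcn)
    _ = 18 * c n * ∫ ω, ℓ n t ω ^ 2 ∂P := integral_const_mul _ _

/-- **THE MARTINGALE LOSS LAW.**  Likelihood-ratio martingale increments with `|ℓ_{n,t}| ≤ c_n → 0`
and MEAN quadratic variation `E[Σ_{t<k_n} ℓ_{n,t}²] → s`: the reverse training loss of the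
autoregressive flow, `E[−L_n] = E[−Σ_t ℓ_{n,t}]`, converges to `s/2`. [ours] -/
theorem martingale_loss_tendsto (hℓm : ∀ n t, Measurable (ℓ n t)) {c : ℕ → ℝ}
    (hc : ∀ n t ω, |ℓ n t ω| ≤ c n) (hc0 : Tendsto c atTop (𝓝 0))
    (horth : ∀ (n t : ℕ) (F : (Fin t → ℝ) → ℝ) (K' : ℝ), Measurable F → (∀ w, |F w| ≤ K') →
      ∫ ω, F (fun i => ℓ n i ω) * (Real.exp (ℓ n t ω) - 1) ∂P = 0)
    {s : ℝ} (hQ : Tendsto (fun n => ∫ ω, ∑ t ∈ Finset.range (k n), ℓ n t ω ^ 2 ∂P) atTop (𝓝 s)) :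
    Tendsto (fun n => ∫ ω, -(∑ t ∈ Finset.range (k n), ℓ n t ω) ∂P) atTop (𝓝 (s / 2)) := by
  -- notation: `a_n = E[−L_n]`, `b_n = E[Q_n]`
  have hi : ∀ n t, Integrable (ℓ n t) P := fun n t =>
    Integrable.of_bound (hℓm n t).aestronglyMeasurable (c n)
      (ae_of_all _ fun ω => by rw [Real.norm_eq_abs]; exact hc n t ω)
  have hi2 : ∀ n t, Integrable (fun ω => ℓ n t ω ^ 2) P := fun n t => by
    refine Integrable.of_bound ((hℓm n t).pow_const 2).aestronglyMeasurable (c n ^ 2)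
      (ae_of_all _ fun ω => ?_)
    rw [Real.norm_eq_abs, abs_of_nonneg (sq_nonneg _), ← sq_abs]
    exact pow_le_pow_left₀ (abs_nonneg _) (hc n t ω) 2
  have ha : ∀ n, ∫ ω, -(∑ t ∈ Finset.range (k n), ℓ n t ω) ∂P
      = ∑ t ∈ Finset.range (k n), ∫ ω, -ℓ n t ω ∂P := fun n => by
    rw [integral_neg, integral_finsetSum _ fun t _ => hi n t, ← Finset.sum_neg_distrib]
    simp_rw [integral_neg]
  have hb : ∀ n, ∫ ω, ∑ t ∈ Finset.range (k n), ℓ n t ω ^ 2 ∂P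
      = ∑ t ∈ Finset.range (k n), ∫ ω, ℓ n t ω ^ 2 ∂P := fun n =>
    integral_finsetSum _ fun t _ => hi2 n t
  -- the remainder `r_n = a_n − b_n/2` is `≤ 18 c_n b_n` in absolute value, eventually
  have hcn : ∀ᶠ n in atTop, c n ≤ 1 / 4 := by
    have := (tendsto_order.1 hc0).2 (1 / 4) (by norm_num)
    exact this.mono fun n hn => hn.le
  have hr : ∀ᶠ n in atTop, |(∫ ω, -(∑ t ∈ Finset.range (k n), ℓ n t ω) ∂P)
      - (∫ ω, ∑ t ∈ Finset.range (k n), ℓ n t ω ^ 2 ∂P) / 2|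
      ≤ 18 * |c n| * |∫ ω, ∑ t ∈ Finset.range (k n), ℓ n t ω ^ 2 ∂P| := by
    filter_upwards [hcn] with n hn
    rw [ha n, hb n, Finset.sum_div, ← Finset.sum_sub_distrib]
    have hb0 : 0 ≤ ∑ t ∈ Finset.range (k n), ∫ ω, ℓ n t ω ^ 2 ∂P :=
      Finset.sum_nonneg fun t _ => integral_nonneg fun ω => sq_nonneg _
    calc |∑ t ∈ Finset.range (k n), ((∫ ω, -ℓ n t ω ∂P) - (∫ ω, ℓ n t ω ^ 2 ∂P) / 2)|
        ≤ ∑ t ∈ Finset.range (k n), |(∫ ω, -ℓ n t ω ∂P) - (∫ ω, ℓ n t ω ^ 2 ∂P) / 2| :=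
          Finset.abs_sum_le_sum_abs _ _
      _ ≤ ∑ t ∈ Finset.range (k n), 18 * c n * ∫ ω, ℓ n t ω ^ 2 ∂P :=
          Finset.sum_le_sum fun t _ => abs_integral_neg_sub_half_integral_sq_le hℓm hc horth hn t
      _ = 18 * c n * ∑ t ∈ Finset.range (k n), ∫ ω, ℓ n t ω ^ 2 ∂P := by rw [Finset.mul_sum]
      _ ≤ 18 * |c n| * |∑ t ∈ Finset.range (k n), ∫ ω, ℓ n t ω ^ 2 ∂P| := by
          rw [abs_of_nonneg hb0]
          exact mul_le_mul_of_nonneg_right (mul_le_mul_of_nonneg_left (le_abs_self _) (by norm_num)) hb0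
  -- `r_n → 0`
  have hr0 : Tendsto (fun n => (∫ ω, -(∑ t ∈ Finset.range (k n), ℓ n t ω) ∂P)
      - (∫ ω, ∑ t ∈ Finset.range (k n), ℓ n t ω ^ 2 ∂P) / 2) atTop (𝓝 0) := by
    have hbound : Tendsto (fun n => 18 * |c n| * |∫ ω, ∑ t ∈ Finset.range (k n), ℓ n t ω ^ 2 ∂P|)
        atTop (𝓝 0) := by
      have h := ((continuous_abs.tendsto 0).comp hc0).const_mul 18
      have h' := (continuous_abs.tendsto s).comp hQ
      simp only [Function.comp_def, abs_zero, mul_zero] at h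
      have := h.mul h'
      simpa using this
    exact squeeze_zero_norm' (by filter_upwards [hr] with n hn; simpa [Real.norm_eq_abs] using hn) hbound
  -- `a_n = r_n + b_n/2`
  have h := hr0.add (hQ.div_const 2)
  rw [zero_add] at h
  refine h.congr fun n => ?_
  ring

end Martingale

end Summit.Ventures.LatticeQCDFlow.Theory2

end
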